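import Literature.AlgebraicGeometry.ShimuraVarieties.UnitaryCurveConeChart
import Mathlib.Analysis.Calculus.FDeriv.RestrictScalars
import HarnessLib

/-!
# Cauchy–Riemann along the `𝔭`-probe ⇒ holomorphy on the cone (rank `2`): `IsConeHol` from group data

Topic `AlgebraicGeometry/ShimuraVarieties`; namespace `Literature.AlgebraicGeometry.ShimuraVarieties.UnitaryCurveCone`.  THEOREMS ONLY (no `def`,
no instance, no notation, no named fact, no `sorry`); imports ★ `UnitaryCurveConeChart` (the cone chart: real differentiability of `Φ` at `u ∈ U`
from differentiability of the probe; `ℂ`-linearity of the differential on `u · Stab(ℂ v₀)`) over ★ `UnitaryCurveConeExtension`.  Third and last file of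
the rank-2 CONE DICTIONARY.

MAIN RESULTS (setting of ★ `UnitaryCurveConeChart`).
* §1 `hasFDerivAt_probe` — the probe differential is `z ↦ D (u · X z)`; **`differentiableAt_complex_of_coneLaw_of_probeCR`** — if the probe at `u` is
  real-differentiable with `ℂ`-LINEAR differential (Cauchy–Riemann along `𝔭`: `Dψ (I z) = I Dψ z`), then `Φ` is COMPLEX-differentiable at `u`:
  `M₂(ℂ) = u · X(ℂ) + u · Stab(ℂ v₀)`, the differential is `ℂ`-linear on the second summand by the cone law and on the first by hypothesis, and
  the antilinear defect `I · X z − X (I z)` lies in `Stab(ℂ v₀)` with frame coordinates `k = a = 0`; **`isConeHol_of_coneLaw_of_probeCR`** — with this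
  at every `u ∈ U`, `IsConeHol 𝔣 Φ` (complex differentiability at `u b` by right translation by `b⁻¹` and the law).
* §2 **`exists_isConeHol_extension_of_probeCR`** — THE DICTIONARY: every `φ : U → ℂ` with the cotangent `K_∞`-law whose probes `z ↦ φ (u · exp (X z))`
  are real-differentiable at `0` with `ℂ`-linear differentials is the restriction of an `IsConeHol 𝔣` function — exactly clause (H) of ★
  `holCotForms₂` for one slice, from data on the group (the rank-2, chart-free twin of ★ `BallForms.mem_holomorphic_of_differentiableAt_expP`); and the
  converse `probeCR_of_isConeHol`.
* §3 **`mem_holCotForms₂_of_probeCR`** — the same in the carriers' currency: `f ∈ holCotForms₂ … 𝔣` for a left-invariant, `K_c`-invariant, smooth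
  `f` on `U(J)(𝔸_F)` of right cotangent `K_∞`-type at `w₁` whose `𝔭`-probes at every adelic point are real-differentiable with `ℂ`-linear
  differential (★ `mem_holCotForms₂_iff` + §2 on each slice `u ↦ f (x · adelicSingle w₁ u)`).
Borel (1997) §5.13–§5.14 (holomorphy of a form on the upper half plane ⟺ the Cauchy–Riemann ∕ lowering-operator condition on the group function);
Bergeron–Millson–Moeglin (2016) Part 2 §1.3 (the cone over the ball).  Cell `hodgecm-mathlib`, floor 0, K-groundwork for the P5 named fact TP₂
(`UnitaryCurveForms.holCotFormSpectralProjection₂`); seat A-p14 (g16).  HC_CM is proved only modulo the printed citations until rung 0 closes; nothing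
printed is asserted here.

## References
* [Borel1997] A. Borel, *Automorphic forms on SL₂(ℝ)*, Cambridge Tracts in Math. 130 (1997), §5.13–§5.14.
* [BergeronMillsonMoeglin2016Balls] N. Bergeron, J. Millson, C. Moeglin, Acta Math. 216 (2016), Part 2 §1.3.
* [Hall2015] B. Hall, *Lie Groups, Lie Algebras, and Representations*, 2nd ed., GTM 222 (2015), Prop. 2.3–2.4. -/

set_option autoImplicit false

noncomputable section

open Matrix NumberField NumberField.InfinitePlace
open scoped Matrix ComplexConjugate ComplexOrder
open Literature.NumberTheory.Automorphic Literature.NumberTheory.Automorphic.UnitaryGroup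
open Literature.NumberTheory.Automorphic.UnitaryCurveForms

namespace Literature.AlgebraicGeometry.ShimuraVarieties.UnitaryCurveCone

variable {E : Type} [Field E] {J : Matrix (Fin 2) (Fin 2) E} {w₁ : {w : InfinitePlace E // IsComplex w}}

/-! ### §1. Cauchy–Riemann along the probe ⇒ complex differentiability ⇒ `IsConeHol` -/

section Holomorphy

open scoped Matrix.Norms.Operator
open _root_.Topology Filter

variable (𝔣 : ConeFrame E J w₁)

/-- An `ℝ`-linear functional on a complex normed space that commutes with `I` is `ℂ`-linear. [folklore] -/
private theorem exists_restrictScalars_eq' {V : Type*} [NormedAddCommGroup V] [NormedSpace ℂ V] (D : V →L[ℝ] ℂ)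
    (hD : ∀ v, D (Complex.I • v) = Complex.I * D v) : ∃ D' : V →L[ℂ] ℂ, D'.restrictScalars ℝ = D := by
  refine ⟨{ toFun := D, map_add' := D.map_add, map_smul' := fun c v => ?_, cont := D.continuous }, rfl⟩
  rw [RingHom.id_apply, smul_eq_mul]
  conv_lhs => rw [← Complex.re_add_im c]
  rw [add_smul, mul_smul, Complex.coe_smul, Complex.coe_smul, D.map_add, D.map_smul, D.map_smul, hD,
    Complex.real_smul, Complex.real_smul]
  conv_rhs => rw [← Complex.re_add_im c]
  ring

/-- **The probe differential is the Fréchet differential along `u · X(·)`**: if `g ↦ Φ g` has real derivative `D` at `u`, then the probe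
`z ↦ Φ(u · exp (X z))` has real derivative `z ↦ D (u · X z)` at `0` (chain rule; `exp` has derivative `1` at `0`).
[cite: Borel1997, §5.13–§5.14] [cite: Hall2015, Prop. 2.3–2.4] -/
theorem hasFDerivAt_probe (X : ℂ →ₗ[ℝ] Matrix (Fin 2) (Fin 2) ℂ) (Φ : Matrix (Fin 2) (Fin 2) ℂ → ℂ) (u : archLocal E 2 J w₁)
    {D : (Fin 2 → Fin 2 → ℂ) →L[ℝ] ℂ}
    (hD : HasFDerivAt (fun g : Fin 2 → Fin 2 → ℂ => Φ (Matrix.of g)) D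
      (Matrix.of.symm ((u : GL (Fin 2) ℂ) : Matrix (Fin 2) (Fin 2) ℂ))) :
    HasFDerivAt (fun z : ℂ => Φ (((u : GL (Fin 2) ℂ) : Matrix (Fin 2) (Fin 2) ℂ) * NormedSpace.exp (X z)))
      (D.comp ((LinearMap.toContinuousLinearMap (Matrix.ofLinearEquiv ℝ).symm.toLinearMap).comp
        (((u : GL (Fin 2) ℂ) : Matrix (Fin 2) (Fin 2) ℂ) • LinearMap.toContinuousLinearMap X))) 0 := by
  set uM : Matrix (Fin 2) (Fin 2) ℂ := ((u : GL (Fin 2) ℂ) : Matrix (Fin 2) (Fin 2) ℂ) with huM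
  set XL : ℂ →L[ℝ] Matrix (Fin 2) (Fin 2) ℂ := LinearMap.toContinuousLinearMap X with hXLdef
  set idL : Matrix (Fin 2) (Fin 2) ℂ →L[ℝ] (Fin 2 → Fin 2 → ℂ) :=
    LinearMap.toContinuousLinearMap (Matrix.ofLinearEquiv ℝ).symm.toLinearMap with hidLdef
  have hXL : ∀ z, XL z = X z := fun z => rfl
  have hidL : ∀ A, idL A = Matrix.of.symm A := fun A => rfl
  have h1 : HasFDerivAt (fun z : ℂ => NormedSpace.exp (XL z)) XL 0 := by
    have hexp0 : HasFDerivAt (NormedSpace.exp : Matrix (Fin 2) (Fin 2) ℂ → Matrix (Fin 2) (Fin 2) ℂ)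
        (1 : Matrix (Fin 2) (Fin 2) ℂ →L[ℝ] Matrix (Fin 2) (Fin 2) ℂ) (XL 0) := by
      rw [map_zero]; exact hasFDerivAt_exp_zero
    exact (hexp0.comp (0 : ℂ) XL.hasFDerivAt).congr_fderiv (by ext1 z; rfl)
  have h2 : HasFDerivAt (fun z : ℂ => idL (uM * NormedSpace.exp (XL z))) (idL.comp (uM • XL)) 0 :=
    idL.hasFDerivAt.comp (0 : ℂ) (h1.const_mul uM)
  have hpt : idL (uM * NormedSpace.exp (XL 0)) = Matrix.of.symm uM := by
    rw [map_zero, NormedSpace.exp_zero, Matrix.mul_one, hidL]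
  have hD' : HasFDerivAt (fun g : Fin 2 → Fin 2 → ℂ => Φ (Matrix.of g)) D (idL (uM * NormedSpace.exp (XL 0))) := by
    rw [hpt]; exact hD
  have h := hD'.comp (0 : ℂ) h2
  exact h

/-- **CAUCHY–RIEMANN ALONG THE PROBE ⇒ `ℂ`-DIFFERENTIABILITY AT `u`.**  With the cone law, a `𝔭`-probe `X` of the frame and `u ∈ U`: if the probe
`ψ(z) = Φ(u · exp (X z))` is real-differentiable at `0` with `ℂ`-LINEAR differential (`Dψ(I z) = I Dψ(z)`), then `g ↦ Φ g` is
COMPLEX-differentiable at `u`.  PROOF: `Φ` is real-differentiable at `u` (`differentiableAt_real_of_coneLaw_of_probe`) with differential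
`D`; every direction is `u (X ζ + Y)` with `Y ∈ Stab(ℂ v₀)`; on `u · Stab(ℂ v₀)` `D` is `ℂ`-linear by the law (`fderiv_apply_smul_stab`), on
`u · X(ℂ)` it is the probe differential (`hasFDerivAt_probe`), and `I · X ζ − X (I ζ) ∈ Stab(ℂ v₀)` is unipotent (frame coordinates
`k = a = 0`), so `D (I w) = I D w`. [cite: Borel1997, §5.13–§5.14] [cite: BergeronMillsonMoeglin2016Balls, Part 2 §1.3] -/
theorem differentiableAt_complex_of_coneLaw_of_probeCR (hJ : (J.map w₁.1.embedding).IsHermitian)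
    (X : ℂ →ₗ[ℝ] Matrix (Fin 2) (Fin 2) ℂ) (hXu : ∀ z, (X z)ᴴ * J.map w₁.1.embedding + J.map w₁.1.embedding * X z = 0)
    (hXv : ∀ z, X z *ᵥ 𝔣.v₀ = z • 𝔣.t₀) (hXt : ∀ z, ∃ c : ℂ, X z *ᵥ 𝔣.t₀ = c • 𝔣.v₀)
    (Φ : Matrix (Fin 2) (Fin 2) ℂ → ℂ)
    (hlaw : ∀ (g b : Matrix (Fin 2) (Fin 2) ℂ) (a k d : ℂ), IsUnit g → g *ᵥ 𝔣.v₀ ∈ negCone (J.map w₁.1.embedding) → k ≠ 0 →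
      b *ᵥ 𝔣.v₀ = k • 𝔣.v₀ → b *ᵥ 𝔣.t₀ = a • 𝔣.t₀ + d • 𝔣.v₀ → Φ (g * b) = (a * k⁻¹) * Φ g)
    (u : archLocal E 2 J w₁)
    (hψ : DifferentiableAt ℝ (fun z : ℂ => Φ (((u : GL (Fin 2) ℂ) : Matrix (Fin 2) (Fin 2) ℂ) * NormedSpace.exp (X z))) 0)
    (hCR : ∀ z : ℂ, fderiv ℝ (fun z : ℂ => Φ (((u : GL (Fin 2) ℂ) : Matrix (Fin 2) (Fin 2) ℂ) * NormedSpace.exp (X z))) 0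
        (Complex.I • z) =
      Complex.I • fderiv ℝ (fun z : ℂ => Φ (((u : GL (Fin 2) ℂ) : Matrix (Fin 2) (Fin 2) ℂ) * NormedSpace.exp (X z))) 0 z) :
    DifferentiableAt ℂ (fun g : Fin 2 → Fin 2 → ℂ => Φ (Matrix.of g))
      (Matrix.of.symm ((u : GL (Fin 2) ℂ) : Matrix (Fin 2) (Fin 2) ℂ)) := by
  set uM : Matrix (Fin 2) (Fin 2) ℂ := ((u : GL (Fin 2) ℂ) : Matrix (Fin 2) (Fin 2) ℂ) with huM
  have hu : IsUnit uM := (isUnit_and_mulVec_mem_negCone 𝔣 u).1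
  have hreal := differentiableAt_real_of_coneLaw_of_probe 𝔣 hJ X hXu hXv hXt Φ hlaw u hψ
  set D := fderiv ℝ (fun g : Fin 2 → Fin 2 → ℂ => Φ (Matrix.of g)) (Matrix.of.symm uM) with hDdef
  have hD : HasFDerivAt (fun g : Fin 2 → Fin 2 → ℂ => Φ (Matrix.of g)) D (Matrix.of.symm uM) := hreal.hasFDerivAt
  -- the probe differential
  set Dψ := fderiv ℝ (fun z : ℂ => Φ (uM * NormedSpace.exp (X z))) 0 with hDψ
  have hprobe := hasFDerivAt_probe X Φ u hD
  have hDX : ∀ z : ℂ, D (Matrix.of.symm (uM * X z)) = Dψ z := fun z => by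
    rw [hDψ, hprobe.fderiv]
    rfl
  -- `ℂ`-linearity of `D`
  have hlin : ∀ W : Fin 2 → Fin 2 → ℂ, D (Complex.I • W) = Complex.I * D W := by
    intro W
    -- decompose `of W = u (X α + Y)` with `Y ∈ Stab(ℂ v₀)`
    set V : Matrix (Fin 2) (Fin 2) ℂ := (((u : GL (Fin 2) ℂ)⁻¹ : GL (Fin 2) ℂ) : Matrix (Fin 2) (Fin 2) ℂ) * Matrix.of W
      with hV
    have hWV : Matrix.of W = uM * V := by
      rw [hV, ← Matrix.mul_assoc, ← Units.val_mul, mul_inv_cancel, Units.val_one, Matrix.one_mul]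
    obtain ⟨α, β, hVv⟩ := exists_frame_coords 𝔣 hJ (V *ᵥ 𝔣.v₀)
    set Y : Matrix (Fin 2) (Fin 2) ℂ := V - X α with hY
    have hYv : Y *ᵥ 𝔣.v₀ = β • 𝔣.v₀ := by rw [hY, sub_mulVec, hXv, hVv, add_sub_cancel_left]
    obtain ⟨aY, dY, hYt⟩ := exists_frame_coords 𝔣 hJ (Y *ᵥ 𝔣.t₀)
    obtain ⟨c₁, hc₁⟩ := hXt α
    obtain ⟨c₂, hc₂⟩ := hXt (Complex.I • α)
    -- `W` and `I • W` as sums of a probe direction and a stabiliser direction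
    have hW : W = Matrix.of.symm (uM * X α) + (1 : ℂ) • Matrix.of.symm (uM * Y) := by
      rw [one_smul]
      apply Matrix.of.injective
      rw [hWV]
      change uM * V = uM * X α + uM * Y
      rw [← Matrix.mul_add, hY, add_sub_cancel]
    set Y' : Matrix (Fin 2) (Fin 2) ℂ := Complex.I • X α - X (Complex.I • α) + Complex.I • Y with hY'
    have hY'v : Y' *ᵥ 𝔣.v₀ = (Complex.I * β) • 𝔣.v₀ := by
      rw [hY', add_mulVec, sub_mulVec, smul_mulVec, smul_mulVec, hXv, hXv, hYv, smul_smul, smul_smul, smul_eq_mul, sub_self,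
        zero_add]
    have hY't : Y' *ᵥ 𝔣.t₀ = (Complex.I * aY) • 𝔣.t₀ + (Complex.I * c₁ - c₂ + Complex.I * dY) • 𝔣.v₀ := by
      rw [hY', add_mulVec, sub_mulVec, smul_mulVec, smul_mulVec, hc₁, hc₂, hYt]
      module
    have hIW : Complex.I • W = Matrix.of.symm (uM * X (Complex.I • α)) + (1 : ℂ) • Matrix.of.symm (uM * Y') := by
      rw [one_smul, hW, one_smul]
      apply Matrix.of.injective
      change Complex.I • (uM * X α + uM * Y) = uM * X (Complex.I • α) + uM * Y'
      rw [hY', smul_add, ← Matrix.mul_smul, ← Matrix.mul_smul, Matrix.mul_add, Matrix.mul_sub]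
      abel
    -- evaluate `D` on both
    have h1 := fderiv_apply_smul_stab 𝔣 Φ hlaw u hD hYv hYt 1
    have h2 := fderiv_apply_smul_stab 𝔣 Φ hlaw u hD hY'v hY't 1
    rw [hIW, map_add, h2, hDX, hCR, hW, map_add, h1, hDX, smul_eq_mul]
    ring
  obtain ⟨D', hD'⟩ := exists_restrictScalars_eq' D hlin
  exact (differentiableAt_iff_restrictScalars ℝ hreal).2 ⟨D', hD'⟩

/-- **CONE HOLOMORPHY FROM THE CONE LAW AND CAUCHY–RIEMANN ALONG THE PROBE (`IsConeHol` from group data).**  If `Φ : M₂(ℂ) → ℂ` obeys the cone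
law of the frame `𝔣`, and for EVERY `u ∈ U = U(Jw)` the probe `z ↦ Φ(u · exp (X z))` is real-differentiable at `0` with `ℂ`-linear differential,
then `IsConeHol 𝔣 Φ`: `Φ` is complex-differentiable on the cone-open `{g | IsUnit g ∧ g v₀ ∈ negCone}` (at `u b` by right translation by
`b⁻¹`, a `ℂ`-linear map carrying the cone-open near `u b` to the cone-open near `u`, and the law `Φ(m) = (a k⁻¹) Φ(m b⁻¹)`), and the law holds
by hypothesis.  This is the rank-2, model-free converse of the cone reading ★ `UnitaryBallConeCotangentHolomorphy` and the rank-2 twin of ★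
`BallForms.mem_holomorphic_of_differentiableAt_expP`. [cite: Borel1997, §5.13–§5.14] [cite: BergeronMillsonMoeglin2016Balls, Part 2 §1.3] -/
theorem isConeHol_of_coneLaw_of_probeCR (hJ : (J.map w₁.1.embedding).IsHermitian)
    (X : ℂ →ₗ[ℝ] Matrix (Fin 2) (Fin 2) ℂ) (hXu : ∀ z, (X z)ᴴ * J.map w₁.1.embedding + J.map w₁.1.embedding * X z = 0)
    (hXv : ∀ z, X z *ᵥ 𝔣.v₀ = z • 𝔣.t₀) (hXt : ∀ z, ∃ c : ℂ, X z *ᵥ 𝔣.t₀ = c • 𝔣.v₀)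
    (Φ : Matrix (Fin 2) (Fin 2) ℂ → ℂ)
    (hlaw : ∀ (g b : Matrix (Fin 2) (Fin 2) ℂ) (a k d : ℂ), IsUnit g → g *ᵥ 𝔣.v₀ ∈ negCone (J.map w₁.1.embedding) → k ≠ 0 →
      b *ᵥ 𝔣.v₀ = k • 𝔣.v₀ → b *ᵥ 𝔣.t₀ = a • 𝔣.t₀ + d • 𝔣.v₀ → Φ (g * b) = (a * k⁻¹) * Φ g)
    (hψ : ∀ u : archLocal E 2 J w₁,
      DifferentiableAt ℝ (fun z : ℂ => Φ (((u : GL (Fin 2) ℂ) : Matrix (Fin 2) (Fin 2) ℂ) * NormedSpace.exp (X z))) 0)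
    (hCR : ∀ (u : archLocal E 2 J w₁) (z : ℂ),
      fderiv ℝ (fun z : ℂ => Φ (((u : GL (Fin 2) ℂ) : Matrix (Fin 2) (Fin 2) ℂ) * NormedSpace.exp (X z))) 0 (Complex.I • z) =
        Complex.I • fderiv ℝ (fun z : ℂ => Φ (((u : GL (Fin 2) ℂ) : Matrix (Fin 2) (Fin 2) ℂ) * NormedSpace.exp (X z))) 0 z) :
    IsConeHol 𝔣 Φ := by
  refine ⟨?_, hlaw⟩
  intro g hg
  obtain ⟨hgu, hgv⟩ := hg
  -- factorise `g = u b`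
  obtain ⟨p, hfac, hk, ha, hbv, hbt⟩ := exists_factorisation 𝔣 hJ hgu hgv
  set u := p.1 with hudef
  set b := p.2.1 with hbdef
  set k := p.2.2.1 with hkdef
  set a := p.2.2.2.1 with hadef
  set d := p.2.2.2.2 with hddef
  set uM : Matrix (Fin 2) (Fin 2) ℂ := ((u : GL (Fin 2) ℂ) : Matrix (Fin 2) (Fin 2) ℂ) with huM
  have hbu : IsUnit b := isUnit_of_frame_coords 𝔣 hJ hk ha hbv hbt
  obtain ⟨bu, hbu'⟩ := hbu
  -- right translation by `b⁻¹`
  let R : (Fin 2 → Fin 2 → ℂ) →L[ℂ] (Fin 2 → Fin 2 → ℂ) :=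
    LinearMap.toContinuousLinearMap
      { toFun := fun m => Matrix.of.symm (Matrix.of m * ((bu⁻¹ : (Matrix (Fin 2) (Fin 2) ℂ)ˣ) : Matrix (Fin 2) (Fin 2) ℂ))
        map_add' := fun m m' => by
          apply Matrix.of.injective
          change Matrix.of (m + m') * _ = Matrix.of m * _ + Matrix.of m' * _
          rw [← Matrix.add_mul]; rfl
        map_smul' := fun c m => by
          apply Matrix.of.injective
          change Matrix.of (c • m) * _ = c • (Matrix.of m * _)
          rw [← Matrix.smul_mul]; rfl }
  have hR : ∀ m : Fin 2 → Fin 2 → ℂ, Matrix.of (R m) = Matrix.of m * ((bu⁻¹ : (Matrix (Fin 2) (Fin 2) ℂ)ˣ) : Matrix (Fin 2) (Fin 2) ℂ) :=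
    fun m => rfl
  have hRg : R g = Matrix.of.symm uM := by
    apply Matrix.of.injective
    rw [hR, hfac, ← hbu', Matrix.mul_assoc, Units.mul_inv, Matrix.mul_one]
    rfl
  -- `Φ` near `g` is `(a k⁻¹) • Φ ∘ R`
  have hopen : IsOpen {m : Fin 2 → Fin 2 → ℂ | IsUnit (Matrix.of m) ∧ Matrix.of m *ᵥ 𝔣.v₀ ∈ negCone (J.map w₁.1.embedding)} := by
    have hid : Continuous fun m : Fin 2 → Fin 2 → ℂ => Matrix.of m := continuous_id
    have h1 : IsOpen {m : Fin 2 → Fin 2 → ℂ | IsUnit (Matrix.of m)} := by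
      have h : {m : Fin 2 → Fin 2 → ℂ | IsUnit (Matrix.of m)} = (fun m : Fin 2 → Fin 2 → ℂ => (Matrix.of m).det) ⁻¹' {0}ᶜ := by
        ext m
        simp only [Set.mem_setOf_eq, Set.mem_preimage, Set.mem_compl_iff, Set.mem_singleton_iff, Matrix.isUnit_iff_isUnit_det,
          isUnit_iff_ne_zero]
      rw [h]
      exact isOpen_compl_singleton.preimage hid.matrix_det
    have h2 : IsOpen {m : Fin 2 → Fin 2 → ℂ | Matrix.of m *ᵥ 𝔣.v₀ ∈ negCone (J.map w₁.1.embedding)} :=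
      (isOpen_negCone _).preimage (hid.matrix_mulVec continuous_const)
    exact h1.inter h2
  have hev : (fun m : Fin 2 → Fin 2 → ℂ => Φ (Matrix.of m)) =ᶠ[𝓝 g]
      fun m => (a * k⁻¹) * (fun m' : Fin 2 → Fin 2 → ℂ => Φ (Matrix.of m')) (R m) := by
    filter_upwards [hopen.mem_nhds (show g ∈ _ from ⟨hgu, hgv⟩)] with m hm
    obtain ⟨hmu, hmv⟩ := hm
    have hmb : IsUnit (Matrix.of m * ((bu⁻¹ : (Matrix (Fin 2) (Fin 2) ℂ)ˣ) : Matrix (Fin 2) (Fin 2) ℂ)) := hmu.mul (Units.isUnit _)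
    have hbinv : ((bu⁻¹ : (Matrix (Fin 2) (Fin 2) ℂ)ˣ) : Matrix (Fin 2) (Fin 2) ℂ) *ᵥ 𝔣.v₀ = k⁻¹ • 𝔣.v₀ := by
      have h := congrArg (fun w => ((bu⁻¹ : (Matrix (Fin 2) (Fin 2) ℂ)ˣ) : Matrix (Fin 2) (Fin 2) ℂ) *ᵥ ((k⁻¹ : ℂ) • w)) hbv
      simp only [mulVec_smul, smul_smul, inv_mul_cancel₀ hk, one_smul] at h
      rw [← hbu', mulVec_mulVec, Units.inv_mul, one_mulVec] at h
      exact h.symm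
    have hmbv : (Matrix.of m * ((bu⁻¹ : (Matrix (Fin 2) (Fin 2) ℂ)ˣ) : Matrix (Fin 2) (Fin 2) ℂ)) *ᵥ 𝔣.v₀ ∈
        negCone (J.map w₁.1.embedding) := by
      rw [← mulVec_mulVec, hbinv, mulVec_smul]
      exact smul_mem_negCone (inv_ne_zero hk) hmv
    have hlaw' := hlaw _ b a k d hmb hmbv hk hbv hbt
    rw [Matrix.mul_assoc, ← hbu', Units.inv_mul, Matrix.mul_one] at hlaw'
    change Φ (Matrix.of m) = (a * k⁻¹) * Φ (Matrix.of (R m))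
    rw [hR]
    exact hlaw'
  have hdiff : DifferentiableAt ℂ (fun m : Fin 2 → Fin 2 → ℂ => (a * k⁻¹) * (fun m' : Fin 2 → Fin 2 → ℂ => Φ (Matrix.of m')) (R m)) g := by
    have hu' : DifferentiableAt ℂ (fun m' : Fin 2 → Fin 2 → ℂ => Φ (Matrix.of m')) (R g) := by
      rw [hRg]
      exact differentiableAt_complex_of_coneLaw_of_probeCR 𝔣 hJ X hXu hXv hXt Φ hlaw u (hψ u) (hCR u)
    exact (hu'.comp g R.differentiableAt).const_mul _
  exact (hev.differentiableAt_iff.2 hdiff).differentiableWithinAt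

end Holomorphy

/-! ### §2. The dictionary and its converse -/

section Packaging

open scoped Matrix.Norms.Operator
open _root_.Topology Filter

variable (𝔣 : ConeFrame E J w₁)

/-- **THE RANK-2 CONE DICTIONARY (group data ⇒ `IsConeHol` extension).**  Let `Jw = σ_{w₁} J` be hermitian, `𝔣` a cone frame, `X` a `𝔭`-probe
of the frame with its one-parameter family `γ z = exp (X z) ∈ U` (★ `exists_coneProbe`, ★ `exists_expFamily_archLocal`).  Every `φ : U → ℂ` with
(i) the cotangent `K_∞`-LAW, (ii) probes `z ↦ φ (u · γ z)` real-differentiable at `0` for every `u ∈ U`, (iii) with `ℂ`-LINEAR probe differentials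
(Cauchy–Riemann along `𝔭`), is the restriction to `U` of an `IsConeHol 𝔣` function on `M₂(ℂ)` — i.e. it satisfies clause (H) of ★ `holCotForms₂` for a
slice.  (★ `exists_coneExtension` + `isConeHol_of_coneLaw_of_probeCR`.)  The rank-2, chart-free twin of ★ `BallForms.mem_holomorphic_of_differentiableAt_expP`.
[cite: Borel1997, §5.13–§5.14] [cite: BergeronMillsonMoeglin2016Balls, Part 2 §1.3] -/
theorem exists_isConeHol_extension_of_probeCR (hJ : (J.map w₁.1.embedding).IsHermitian)
    (X : ℂ →ₗ[ℝ] Matrix (Fin 2) (Fin 2) ℂ) (hXu : ∀ z, (X z)ᴴ * J.map w₁.1.embedding + J.map w₁.1.embedding * X z = 0)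
    (hXv : ∀ z, X z *ᵥ 𝔣.v₀ = z • 𝔣.t₀) (hXt : ∀ z, ∃ c : ℂ, X z *ᵥ 𝔣.t₀ = c • 𝔣.v₀)
    (γ : ℂ → archLocal E 2 J w₁) (hγ : ∀ z, ((γ z : GL (Fin 2) ℂ) : Matrix (Fin 2) (Fin 2) ℂ) = NormedSpace.exp (X z))
    (φ : archLocal E 2 J w₁ → ℂ)
    (hφ : ∀ (u κ : archLocal E 2 J w₁) (a k d : ℂ), k ≠ 0 →
      ((κ : GL (Fin 2) ℂ) : Matrix (Fin 2) (Fin 2) ℂ) *ᵥ 𝔣.v₀ = k • 𝔣.v₀ →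
      ((κ : GL (Fin 2) ℂ) : Matrix (Fin 2) (Fin 2) ℂ) *ᵥ 𝔣.t₀ = a • 𝔣.t₀ + d • 𝔣.v₀ → φ (u * κ) = a * k⁻¹ * φ u)
    (hdiff : ∀ u : archLocal E 2 J w₁, DifferentiableAt ℝ (fun z : ℂ => φ (u * γ z)) 0)
    (hCR : ∀ (u : archLocal E 2 J w₁) (z : ℂ),
      fderiv ℝ (fun z : ℂ => φ (u * γ z)) 0 (Complex.I • z) = Complex.I • fderiv ℝ (fun z : ℂ => φ (u * γ z)) 0 z) :
    ∃ Φ : Matrix (Fin 2) (Fin 2) ℂ → ℂ, IsConeHol 𝔣 Φ ∧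
      ∀ u : archLocal E 2 J w₁, Φ ((u : GL (Fin 2) ℂ) : Matrix (Fin 2) (Fin 2) ℂ) = φ u := by
  obtain ⟨Φ, hlaw, hres, -⟩ := exists_coneExtension 𝔣 hJ φ hφ
  have hfun : ∀ u : archLocal E 2 J w₁,
      (fun z : ℂ => Φ (((u : GL (Fin 2) ℂ) : Matrix (Fin 2) (Fin 2) ℂ) * NormedSpace.exp (X z))) = fun z => φ (u * γ z) := by
    intro u
    funext z
    rw [← hγ, ← Units.val_mul, ← Subgroup.coe_mul, hres]
  refine ⟨Φ, isConeHol_of_coneLaw_of_probeCR 𝔣 hJ X hXu hXv hXt Φ hlaw (fun u => ?_) (fun u z => ?_), hres⟩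
  · rw [hfun]; exact hdiff u
  · rw [hfun]; exact hCR u z

/-- **CONVERSE: an `IsConeHol` function has differentiable probes with `ℂ`-linear differentials at every `u ∈ U`** (so the hypotheses of
`isConeHol_of_coneLaw_of_probeCR` are also necessary).  The antilinear defect `X (I z) − I · X z` lies in `Stab(ℂ v₀)` with frame coordinates
`k = a = 0`, so it is killed by the differential (`fderiv_apply_smul_stab`). [cite: Borel1997, §5.13–§5.14] -/
theorem probeCR_of_isConeHol (X : ℂ →ₗ[ℝ] Matrix (Fin 2) (Fin 2) ℂ) (hXv : ∀ z, X z *ᵥ 𝔣.v₀ = z • 𝔣.t₀) (hXt : ∀ z, ∃ c : ℂ, X z *ᵥ 𝔣.t₀ = c • 𝔣.v₀)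
    {Φ : Matrix (Fin 2) (Fin 2) ℂ → ℂ} (hΦ : IsConeHol 𝔣 Φ) (u : archLocal E 2 J w₁) :
    DifferentiableAt ℝ (fun z : ℂ => Φ (((u : GL (Fin 2) ℂ) : Matrix (Fin 2) (Fin 2) ℂ) * NormedSpace.exp (X z))) 0 ∧
      ∀ z : ℂ, fderiv ℝ (fun z : ℂ => Φ (((u : GL (Fin 2) ℂ) : Matrix (Fin 2) (Fin 2) ℂ) * NormedSpace.exp (X z))) 0
          (Complex.I • z) =
        Complex.I • fderiv ℝ (fun z : ℂ => Φ (((u : GL (Fin 2) ℂ) : Matrix (Fin 2) (Fin 2) ℂ) * NormedSpace.exp (X z))) 0 z := by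
  set uM : Matrix (Fin 2) (Fin 2) ℂ := ((u : GL (Fin 2) ℂ) : Matrix (Fin 2) (Fin 2) ℂ) with huM
  obtain ⟨hu, huv⟩ := isUnit_and_mulVec_mem_negCone 𝔣 u
  -- `Φ` is `ℂ`-differentiable at `u`
  have hopen : IsOpen {m : Fin 2 → Fin 2 → ℂ | IsUnit (Matrix.of m) ∧ Matrix.of m *ᵥ 𝔣.v₀ ∈ negCone (J.map w₁.1.embedding)} := by
    have hid : Continuous fun m : Fin 2 → Fin 2 → ℂ => Matrix.of m := continuous_id
    have h1 : IsOpen {m : Fin 2 → Fin 2 → ℂ | IsUnit (Matrix.of m)} := by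
      have h : {m : Fin 2 → Fin 2 → ℂ | IsUnit (Matrix.of m)} = (fun m : Fin 2 → Fin 2 → ℂ => (Matrix.of m).det) ⁻¹' {0}ᶜ := by
        ext m
        simp only [Set.mem_setOf_eq, Set.mem_preimage, Set.mem_compl_iff, Set.mem_singleton_iff, Matrix.isUnit_iff_isUnit_det,
          isUnit_iff_ne_zero]
      rw [h]
      exact isOpen_compl_singleton.preimage hid.matrix_det
    have h2 : IsOpen {m : Fin 2 → Fin 2 → ℂ | Matrix.of m *ᵥ 𝔣.v₀ ∈ negCone (J.map w₁.1.embedding)} :=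
      (isOpen_negCone _).preimage (hid.matrix_mulVec continuous_const)
    exact h1.inter h2
  have hdiffC : DifferentiableAt ℂ (fun g : Fin 2 → Fin 2 → ℂ => Φ (Matrix.of g)) (Matrix.of.symm uM) :=
    (hΦ.1 _ ⟨hu, huv⟩).differentiableAt (hopen.mem_nhds ⟨hu, huv⟩)
  set Dc := fderiv ℂ (fun g : Fin 2 → Fin 2 → ℂ => Φ (Matrix.of g)) (Matrix.of.symm uM) with hDc
  have hD : HasFDerivAt (fun g : Fin 2 → Fin 2 → ℂ => Φ (Matrix.of g)) (Dc.restrictScalars ℝ) (Matrix.of.symm uM) :=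
    hdiffC.hasFDerivAt.restrictScalars ℝ
  have hprobe := hasFDerivAt_probe X Φ u hD
  refine ⟨hprobe.differentiableAt, fun z => ?_⟩
  rw [hprobe.fderiv]
  -- the antilinear defect lies in `Stab(ℂ v₀)` with `k = a = 0`
  obtain ⟨c₁, hc₁⟩ := hXt z
  obtain ⟨c₂, hc₂⟩ := hXt (Complex.I • z)
  set M : Matrix (Fin 2) (Fin 2) ℂ := X (Complex.I • z) - Complex.I • X z with hM
  have hMv : M *ᵥ 𝔣.v₀ = (0 : ℂ) • 𝔣.v₀ := by
    rw [hM, sub_mulVec, smul_mulVec, hXv, hXv, smul_smul, smul_eq_mul, sub_self, zero_smul]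
  have hMt : M *ᵥ 𝔣.t₀ = (0 : ℂ) • 𝔣.t₀ + (c₂ - Complex.I * c₁) • 𝔣.v₀ := by
    rw [hM, sub_mulVec, smul_mulVec, hc₁, hc₂, smul_smul, zero_smul, zero_add, sub_smul]
  have hkill := fderiv_apply_smul_stab 𝔣 Φ hΦ.2 u hD hMv hMt 1
  rw [one_smul, sub_self, zero_mul, mul_zero] at hkill
  -- evaluate both sides
  have hsplit : Matrix.of.symm (uM * X (Complex.I • z)) = Complex.I • Matrix.of.symm (uM * X z) + Matrix.of.symm (uM * M) := by
    apply Matrix.of.injective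
    change uM * X (Complex.I • z) = Complex.I • (uM * X z) + uM * M
    rw [hM, Matrix.mul_sub, Matrix.mul_smul]
    abel
  change (Dc.restrictScalars ℝ) (Matrix.of.symm (uM * X (Complex.I • z))) = Complex.I • (Dc.restrictScalars ℝ) (Matrix.of.symm (uM * X z))
  rw [hsplit, map_add, hkill, add_zero, ContinuousLinearMap.coe_restrictScalars', map_smul]

end Packaging

/-! ### §3. In the carriers' currency: membership in `holCotForms₂` from group data -/

section Carriers

open scoped Matrix.Norms.Operator

variable {F : Type} [Field F] [NumberField F] [NumberField E] [Algebra F E] {c : E ≃ₐ[F] E}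
  (hc : c ≠ 1) (hfix : ∀ w : InfinitePlace E, c • w = w) (𝔣 : ConeFrame E J w₁)

/-- **`holCotForms₂` FROM GROUP DATA.**  A function `f` on `U(J)(𝔸_F)` that is left `U(J)(F)`-invariant, right-invariant under the archimedean factor away
from `w₁`, smooth, of right cotangent `K_∞`-TYPE at `w₁` (`f (x · κ) = (a k⁻¹) f x` for `κ ∈ U(σ_{w₁}J)` stabilising `ℂ v₀`), and whose `𝔭`-probes
`z ↦ f (x · exp (X z))` at `w₁` are real-differentiable at `0` with `ℂ`-linear differential at EVERY adelic point `x`, is a HOLOMORPHIC COTANGENT FORM: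
`f ∈ holCotForms₂ … 𝔣` (clause (H) of ★ `mem_holCotForms₂_iff` for the slice at `x` is `exists_isConeHol_extension_of_probeCR` applied to
`u ↦ f (x · adelicSingle w₁ u)`).  The rank-2 twin of the holomorphy half of ★ `mem_holCotForms_iff` + ★ `mem_holomorphic_of_differentiableAt_expP`.
[cite: Borel1997, §5.14] [cite: BergeronMillsonMoeglin2016Balls, Part 2 §1.3] -/
theorem mem_holCotForms₂_of_probeCR (hJ : (J.map w₁.1.embedding).IsHermitian)
    (X : ℂ →ₗ[ℝ] Matrix (Fin 2) (Fin 2) ℂ) (hXu : ∀ z, (X z)ᴴ * J.map w₁.1.embedding + J.map w₁.1.embedding * X z = 0)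
    (hXv : ∀ z, X z *ᵥ 𝔣.v₀ = z • 𝔣.t₀) (hXt : ∀ z, ∃ c : ℂ, X z *ᵥ 𝔣.t₀ = c • 𝔣.v₀)
    (γ : ℂ → archLocal E 2 J w₁) (hγ : ∀ z, ((γ z : GL (Fin 2) ℂ) : Matrix (Fin 2) (Fin 2) ℂ) = NormedSpace.exp (X z))
    {f : (adelicGroupData F E c 2 J).Adelic → ℂ}
    (hL : ∀ (γr : (adelicGroupData F E c 2 J).Rational) (x : (adelicGroupData F E c 2 J).Adelic),
      f ((adelicGroupData F E c 2 J).toAdelic γr * x) = f x)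
    (hKc : ∀ k ∈ ((archAt F E c 2 J w₁ (hfix w₁.1) hc).ker).map (archToAdelic F E c 2 J),
      ∀ x : (adelicGroupData F E c 2 J).Adelic, f (x * k) = f x)
    (hSm : f ∈ smoothFun₂ F E c J)
    (hK : ∀ (x : (adelicGroupData F E c 2 J).Adelic) (κ : archLocal E 2 J w₁) (a k d : ℂ), k ≠ 0 →
      ((κ : GL (Fin 2) ℂ) : Matrix (Fin 2) (Fin 2) ℂ) *ᵥ 𝔣.v₀ = k • 𝔣.v₀ →
      ((κ : GL (Fin 2) ℂ) : Matrix (Fin 2) (Fin 2) ℂ) *ᵥ 𝔣.t₀ = a • 𝔣.t₀ + d • 𝔣.v₀ →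
        f (x * adelicSingle F E c 2 J hc hfix w₁ κ) = a * k⁻¹ * f x)
    (hdiff : ∀ x : (adelicGroupData F E c 2 J).Adelic,
      DifferentiableAt ℝ (fun z : ℂ => f (x * adelicSingle F E c 2 J hc hfix w₁ (γ z))) 0)
    (hCR : ∀ (x : (adelicGroupData F E c 2 J).Adelic) (z : ℂ),
      fderiv ℝ (fun z : ℂ => f (x * adelicSingle F E c 2 J hc hfix w₁ (γ z))) 0 (Complex.I • z) =
        Complex.I • fderiv ℝ (fun z : ℂ => f (x * adelicSingle F E c 2 J hc hfix w₁ (γ z))) 0 z) :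
    f ∈ holCotForms₂ F E c J hc hfix w₁ 𝔣 := by
  rw [mem_holCotForms₂_iff]
  refine ⟨hL, hKc, hSm, fun x => ?_⟩
  -- the slice at `x` as a function on `U`
  set φ : archLocal E 2 J w₁ → ℂ := fun u => f (x * adelicSingle F E c 2 J hc hfix w₁ u) with hφ
  have hφlaw : ∀ (u κ : archLocal E 2 J w₁) (a k d : ℂ), k ≠ 0 →
      ((κ : GL (Fin 2) ℂ) : Matrix (Fin 2) (Fin 2) ℂ) *ᵥ 𝔣.v₀ = k • 𝔣.v₀ →
      ((κ : GL (Fin 2) ℂ) : Matrix (Fin 2) (Fin 2) ℂ) *ᵥ 𝔣.t₀ = a • 𝔣.t₀ + d • 𝔣.v₀ → φ (u * κ) = a * k⁻¹ * φ u := by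
    intro u κ a k d hk hκv hκt
    simp only [hφ, map_mul, ← mul_assoc]
    exact hK _ κ a k d hk hκv hκt
  have hfun : ∀ u : archLocal E 2 J w₁, (fun z : ℂ => φ (u * γ z)) =
      fun z : ℂ => f ((x * adelicSingle F E c 2 J hc hfix w₁ u) * adelicSingle F E c 2 J hc hfix w₁ (γ z)) := by
    intro u; funext z
    simp only [hφ, map_mul, mul_assoc]
  have hφdiff : ∀ u : archLocal E 2 J w₁, DifferentiableAt ℝ (fun z : ℂ => φ (u * γ z)) 0 := fun u => by
    rw [hfun]; exact hdiff _
  have hφCR : ∀ (u : archLocal E 2 J w₁) (z : ℂ),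
      fderiv ℝ (fun z : ℂ => φ (u * γ z)) 0 (Complex.I • z) = Complex.I • fderiv ℝ (fun z : ℂ => φ (u * γ z)) 0 z := fun u z => by
    rw [hfun]; exact hCR _ z
  obtain ⟨Φ, hΦ, hres⟩ := exists_isConeHol_extension_of_probeCR 𝔣 hJ X hXu hXv hXt γ hγ φ hφlaw hφdiff hφCR
  exact ⟨Φ, hΦ, fun u => hres u⟩

end Carriers

end Literature.AlgebraicGeometry.ShimuraVarieties.UnitaryCurveCone

end
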